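import Summits.BirchSwinnertonDyer.BirchSwinnertonDyer.Theorems.GoldfeldAllTwistsTwoConverseTwinAdditiveInertTwistSelmer
import Summits.BirchSwinnertonDyer.BirchSwinnertonDyer.Theorems.GoldfeldAllTwistsTwoConverseTwinAdditiveTwoPrimeTwistSelmer
import HarnessLib

set_option linter.dupNamespace false -- namespace `…BirchSwinnertonDyer.BirchSwinnertonDyer…` is the cell's (D-0017 nested layout)
set_option autoImplicit false

/-!
# Twin″ (item 19140) on the additive INERT-TWIST family, VI: the `2`-isogeny Selmer sets of
# `49a1^{(−2m)}`, `m` squarefree with every prime factor `≡ 1 (mod 4)` and inert in `ℚ(√−7)`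

Cell `bsd-goldfeld`, seat `bsd-goldfeld-s1p-c301` (gen 2); `--supports stmt-BirchSwinnertonDyer-19140`.
Generalises part III (`…TwinAdditiveTwoPrimeTwistSelmer.lean`, `m = ℓ` prime) to composite `m` exactly as
part V generalises part I: for `E_{−2m} : y² = x³ − 42m x² + 448m² x` (`= C₀ • 49a1^{(−2m)}`, conductor
`3136 m²`, type `I₈*` at `2`; `m = 1` is the base curve `49a1^{(−2)}`),

* `mem_of_mem_twoIsogenySelmerGroup_inertTwoTwist`: **`S(−42m, 448m²) ⊆ {1, 2, 7, 14}`** (real place; at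
  each `ℓ ∣ m` the reduced discriminant is `−28 m₁² = −7 (2m₁)²`);
* `mem_of_mem_twoIsogenySelmerGroup'_inertTwoTwist`: **`S(84m, −28m²) ⊆ {1, −7}`** (at `ℓ ∣ m`:
  `7168 m₁² = 7 (32 m₁)²`, `(7/ℓ) = −1`; at `7`: `−1, −2, −4m², −2m²` are non-residues, `7 ∥ 7168 m²`; at
  `2`: part III's `not_isSoluble_two_of_even_coeffs` kills `2` and `−14`, using `m ≡ 1 (mod 4)`, which holds
  because every prime factor of `m` is `≡ 1 (mod 4)`).

PARTITION: types-the-object-of the open P2 cell `r1.addv.borel.split` on the sub-family `𝒟₋₂ = {−2m}` of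
the base family `B₋₂ = 49a1^{(−2)}`. Consequences in part VII. HONEST FRAMING: no `BSD(W,2)` is proved.

## References

* J. H. Silverman, *The Arithmetic of Elliptic Curves*, 2nd ed. (2009), Prop. X.4.9. [SilvermanAEC2009]
* D. Zywina, arXiv:2502.01957, Lemma 3.1 (local lemmas reused from `Zywina2025RankTwo.lean`). [Zywina2025]
-/

noncomputable section

open scoped Classical

open WeierstrassCurve Literature.NumberTheory.EllipticCurves
open Literature.NumberTheory.EllipticCurves.Zywina2025 (isSquare_zmod_of_isSoluble_padic)

namespace Summit.BirchSwinnertonDyer.BirchSwinnertonDyer.Theorems.GoldfeldGoodTwists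

/-! ## §1. Helpers -/

/-- A product of primes `≡ 1 (mod 4)` is `≡ 1 (mod 4)` (squarefree-free version: any `m ≥ 1` all of whose
prime factors are `≡ 1 (mod 4)`). [folklore] -/
theorem mod_four_eq_one_of_forall_prime {m : ℕ} (hm0 : 0 < m)
    (h : ∀ l : ℕ, l.Prime → l ∣ m → l % 4 = 1) : m % 4 = 1 := by
  induction m using Nat.recOnMul with
  | zero => exact absurd hm0 (lt_irrefl 0)
  | one => rfl
  | prime p hp => exact h p hp dvd_rfl
  | mul a b iha ihb =>
    have ha0 : 0 < a := Nat.pos_of_ne_zero fun ha => by simp [ha] at hm0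
    have hb0 : 0 < b := Nat.pos_of_ne_zero fun hb => by simp [hb] at hm0
    have h1 := iha ha0 fun l hl hla => h l hl (hla.mul_right b)
    have h2 := ihb hb0 fun l hl hlb => h l hl (hlb.mul_left a)
    rw [Nat.mul_mod, h1, h2]

/-- Non-residues mod `7`: `−2`, `−4x²`, `−2x²` (`x ≠ 0`). [folklore] -/
theorem zmod_seven_nonresidues_neg_two :
    (∀ r : ZMod 7, r * r ≠ -2) ∧ (∀ x r : ZMod 7, x ≠ 0 → r * r ≠ -4 * x ^ 2) ∧
      (∀ x r : ZMod 7, x ≠ 0 → r * r ≠ -2 * x ^ 2) :=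
  ⟨by decide, by decide, by decide⟩

/-- The residues mod `8` at the prime `2` (`x = m mod 8 ∈ {1,5}`). [folklore] -/
theorem zmod_eight_sums_inert : ∀ x : ZMod 8, x = 1 ∨ x = 5 →
    (1 + 42 * x + -7 * x ^ 2 = 4 ∧ -7 + 42 * x + x ^ 2 = 4) := by
  decide

/-- `m ≡ 1 (mod 4)` ⇒ `m ≡ 1` or `5 (mod 8)` in `ℤ/8`. [folklore] -/
theorem zmod_eight_of_mod_four_eq_one {m : ℕ} (h4 : m % 4 = 1) :
    (m : ZMod 8) = 1 ∨ (m : ZMod 8) = 5 := by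
  have h : m % 8 = 1 ∨ m % 8 = 5 := by omega
  rcases h with h | h
  · left; rw [← ZMod.natCast_mod m 8, h]; norm_num
  · right; rw [← ZMod.natCast_mod m 8, h]; norm_num

/-- `7 ∥ 7168 m²` when `7 ∤ m` (`7168 = 7·1024`). [folklore] -/
theorem not_sq_seven_dvd_of_not_dvd' {m : ℕ} (hm7 : ¬ 7 ∣ m) :
    ¬ ((7 : ℤ) ^ 2 ∣ 7168 * (m : ℤ) ^ 2) := by
  intro h
  have h7p : Prime (7 : ℤ) := Int.prime_iff_natAbs_prime.mpr (by norm_num)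
  have h1 : (7 : ℤ) ∣ 1024 * (m : ℤ) ^ 2 := by
    have h' : (7 : ℤ) * 7 ∣ 7 * (1024 * (m : ℤ) ^ 2) := by
      rw [← pow_two, show (7 : ℤ) * (1024 * (m : ℤ) ^ 2) = 7168 * (m : ℤ) ^ 2 by ring]; exact h
    exact (mul_dvd_mul_iff_left (by norm_num : (7 : ℤ) ≠ 0)).mp h'
  rcases h7p.dvd_or_dvd h1 with h2 | h2
  · norm_num at h2
  · exact hm7 (by exact_mod_cast h7p.dvd_of_dvd_pow h2)

/-! ## §2. The Selmer sets of `E_{−2m} : y² = x³ − 42m x² + 448m² x` -/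

/-- **`S(−42m, 448m²) ⊆ {1, 2, 7, 14}`** for squarefree `m ≥ 1` all of whose prime factors `ℓ` have
`(−7/ℓ) = −1`. [cite: SilvermanAEC2009, Prop. X.4.9 and Example X.4.10] -/
theorem mem_of_mem_twoIsogenySelmerGroup_inertTwoTwist {m : ℕ} (hm0 : 0 < m) (hmsq : Squarefree m)
    (hinert : ∀ l : ℕ, l.Prime → l ∣ m → l % 4 = 1 ∧ ¬ IsSquare ((-7 : ℤ) : ZMod l)) {d : ℤ}
    (hd : d ∈ twoIsogenySelmerGroup (-42 * m) (448 * m ^ 2)) :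
    d ∈ ({1, 2, 7, 14} : Finset ℤ) := by
  have hm0' : (m : ℤ) ≠ 0 := by exact_mod_cast hm0.ne'
  have hb : (448 * m ^ 2 : ℤ) ≠ 0 := by positivity
  rw [mem_twoIsogenySelmerGroup_iff hb] at hd
  obtain ⟨hsqf, ⟨d', hdd'⟩, hloc⟩ := hd
  have hd'eq : (448 * m ^ 2 : ℤ) / d = d' := by
    rw [hdd', Int.mul_ediv_cancel_left _ hsqf.ne_zero]
  rw [hd'eq] at hloc
  obtain ⟨hreal, hpadic⟩ := hloc
  have hdpos : 0 < d := by
    rcases lt_or_gt_of_ne hsqf.ne_zero with hneg | hpos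
    · exfalso
      have hbpos : (0 : ℤ) < 448 * (m : ℤ) ^ 2 := by positivity
      have hd'neg : d' < 0 := by
        by_contra hcon
        nlinarith [mul_nonpos_iff.mpr (Or.inr ⟨hneg.le, le_of_not_gt hcon⟩)]
      have ha : (-42 * (m : ℤ)) ≤ 0 := by
        have : (0 : ℤ) ≤ m := by positivity
        linarith
      exact not_isSoluble_real_twoIsogenyQuartic_of_neg hneg hd'neg ha hreal
    · exact hpos
  have hld : ∀ l : ℕ, l.Prime → l ∣ m → ¬ (l : ℤ) ∣ d := by
    intro l hl hlm
    haveI : Fact l.Prime := ⟨hl⟩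
    have hlp : Prime (l : ℤ) := Nat.prime_iff_prime_int.mp hl
    have hl0 : (l : ℤ) ≠ 0 := by exact_mod_cast hl.ne_zero
    obtain ⟨hl4, hl7⟩ := hinert l hl hlm
    have hl2 : l ≠ 2 := by rintro rfl; norm_num at hl4
    obtain ⟨m₁, rfl⟩ := hlm
    have hlm₁ : ¬ (l : ℤ) ∣ (m₁ : ℤ) := by
      intro h
      have h' : l ∣ m₁ := by exact_mod_cast h
      obtain ⟨m₂, rfl⟩ := h'
      exact hl.one_lt.ne' (Nat.isUnit_iff.mp (hmsq l ⟨m₂, by ring⟩))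
    have h2m₁ : ((2 * (m₁ : ℤ) : ℤ) : ZMod l) ≠ 0 := by
      intro h
      push_cast at h
      rcases mul_eq_zero.mp h with h | h
      · have h2 : ((2 : ℕ) : ZMod l) = 0 := by exact_mod_cast h
        rw [ZMod.natCast_eq_zero_iff] at h2
        exact hl2 ((Nat.prime_dvd_prime_iff_eq hl Nat.prime_two).mp h2)
      · exact hlm₁ ((ZMod.intCast_zmod_eq_zero_iff_dvd _ l).mp (by exact_mod_cast h))
    rintro ⟨e, rfl⟩
    push_cast at hdd' hpadic
    have h1 : e * d' = 448 * l * (m₁ : ℤ) ^ 2 :=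
      mul_left_cancel₀ hl0 (by linear_combination (-1 : ℤ) * hdd')
    have h2 : (l : ℤ) ∣ e * d' := ⟨448 * (m₁ : ℤ) ^ 2, by rw [h1]; ring⟩
    rcases hlp.dvd_or_dvd h2 with h3 | h3
    · obtain ⟨e₁, rfl⟩ := h3
      exact hlp.not_unit (hsqf (l : ℤ) ⟨e₁, by ring⟩)
    · obtain ⟨e', rfl⟩ := h3
      have hm : e * e' = 448 * (m₁ : ℤ) ^ 2 := mul_left_cancel₀ hl0 (by linear_combination h1)
      have hns : ¬ IsSquare ((((-42 * (m₁ : ℤ)) ^ 2 - 4 * (448 * (m₁ : ℤ) ^ 2) : ℤ)) : ZMod l) := by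
        rw [show ((-42 * (m₁ : ℤ)) ^ 2 - 4 * (448 * (m₁ : ℤ) ^ 2) : ℤ) = -7 * (2 * (m₁ : ℤ)) ^ 2 by ring]
        exact not_isSquare_mul_sq_zmod h2m₁ hl7
      exact not_isSoluble_padic_of_prime_dvd_coeffs (p := l) (c := -42 * (m₁ : ℤ)) (by ring) rfl rfl
        hm hns (hpadic l)
  have h14 : d ∣ 14 := by
    have h0 : d ∣ 448 * (m : ℤ) ^ 2 := ⟨d', hdd'⟩
    have h1 : d ∣ (14 * (m : ℤ)) ^ 6 := h0.trans ⟨16807 * (m : ℤ) ^ 4, by ring⟩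
    have h2 : d ∣ 14 * (m : ℤ) := (hsqf.dvd_pow_iff_dvd (by norm_num)).mp h1
    exact (isCoprime_of_forall_prime_not_dvd hld).dvd_of_dvd_mul_right h2
  have hle : d ≤ 14 := Int.le_of_dvd (by norm_num) h14
  interval_cases d <;> first | (exfalso; omega) | simp

/-- **`S'(−42m, 448m²) = S(84m, −28m²) ⊆ {1, −7}`** for squarefree `m ≥ 1` all of whose prime factors `ℓ`
satisfy `ℓ ≡ 1 (mod 4)` and `(−7/ℓ) = −1`. [cite: SilvermanAEC2009, Prop. X.4.9]
[cite: Zywina2025, Lemma 3.1 (proof)] -/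
theorem mem_of_mem_twoIsogenySelmerGroup'_inertTwoTwist {m : ℕ} (hm0 : 0 < m) (hmsq : Squarefree m)
    (hinert : ∀ l : ℕ, l.Prime → l ∣ m → l % 4 = 1 ∧ ¬ IsSquare ((-7 : ℤ) : ZMod l)) {d : ℤ}
    (hd : d ∈ twoIsogenySelmerGroup' (-42 * m) (448 * m ^ 2)) :
    d ∈ ({1, -7} : Finset ℤ) := by
  haveI : Fact (Nat.Prime 7) := ⟨by norm_num⟩
  have hm0' : (m : ℤ) ≠ 0 := by exact_mod_cast hm0.ne'
  have hm4 : m % 4 = 1 := mod_four_eq_one_of_forall_prime hm0 fun l hl hlm => (hinert l hl hlm).1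
  have hmodd : Odd (m : ℤ) := Int.odd_iff.mpr (by omega)
  have hm7 : ¬ 7 ∣ m := fun h =>
    (hinert 7 (by norm_num) h).2
      ⟨0, by rw [(ZMod.intCast_zmod_eq_zero_iff_dvd (-7) 7).mpr ⟨-1, by norm_num⟩]; ring⟩
  have hm07 : ((m : ℤ) : ZMod 7) ≠ 0 := by
    rw [Ne, ZMod.intCast_zmod_eq_zero_iff_dvd]
    exact fun h => hm7 (by exact_mod_cast h)
  have hA : (-2 * (-42 * m : ℤ)) = 84 * m := by ring
  have hB : ((-42 * m : ℤ) ^ 2 - 4 * (448 * m ^ 2)) = -28 * m ^ 2 := by ring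
  rw [twoIsogenySelmerGroup'_eq, hA, hB] at hd
  have hb : (-28 * m ^ 2 : ℤ) ≠ 0 := mul_ne_zero (by norm_num) (pow_ne_zero 2 hm0')
  rw [mem_twoIsogenySelmerGroup_iff hb] at hd
  obtain ⟨hsqf, ⟨d', hdd'⟩, hloc⟩ := hd
  have hd'eq : (-28 * m ^ 2 : ℤ) / d = d' := by
    rw [hdd', Int.mul_ediv_cancel_left _ hsqf.ne_zero]
  rw [hd'eq] at hloc
  obtain ⟨-, hpadic⟩ := hloc
  have hld : ∀ l : ℕ, l.Prime → l ∣ m → ¬ (l : ℤ) ∣ d := by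
    intro l hl hlm
    haveI : Fact l.Prime := ⟨hl⟩
    have hlp : Prime (l : ℤ) := Nat.prime_iff_prime_int.mp hl
    have hl0 : (l : ℤ) ≠ 0 := by exact_mod_cast hl.ne_zero
    obtain ⟨hl4, hl7⟩ := hinert l hl hlm
    have hl2 : l ≠ 2 := by rintro rfl; norm_num at hl4
    obtain ⟨m₁, rfl⟩ := hlm
    have hlm₁ : ¬ (l : ℤ) ∣ (m₁ : ℤ) := by
      intro h
      have h' : l ∣ m₁ := by exact_mod_cast h
      obtain ⟨m₂, rfl⟩ := h'
      exact hl.one_lt.ne' (Nat.isUnit_iff.mp (hmsq l ⟨m₂, by ring⟩))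
    have h32 : ((32 * (m₁ : ℤ) : ℤ) : ZMod l) ≠ 0 := by
      intro h
      push_cast at h
      rcases mul_eq_zero.mp h with h | h
      · have h2 : ((2 ^ 5 : ℕ) : ZMod l) = 0 := by exact_mod_cast h
        rw [ZMod.natCast_eq_zero_iff] at h2
        exact hl2 ((Nat.prime_dvd_prime_iff_eq hl Nat.prime_two).mp (hl.dvd_of_dvd_pow h2))
      · exact hlm₁ ((ZMod.intCast_zmod_eq_zero_iff_dvd _ l).mp (by exact_mod_cast h))
    rintro ⟨e, rfl⟩
    push_cast at hdd' hpadic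
    have h1 : e * d' = -28 * l * (m₁ : ℤ) ^ 2 :=
      mul_left_cancel₀ hl0 (by linear_combination (-1 : ℤ) * hdd')
    have h2 : (l : ℤ) ∣ e * d' := ⟨-28 * (m₁ : ℤ) ^ 2, by rw [h1]; ring⟩
    rcases hlp.dvd_or_dvd h2 with h3 | h3
    · obtain ⟨e₁, rfl⟩ := h3
      exact hlp.not_unit (hsqf (l : ℤ) ⟨e₁, by ring⟩)
    · obtain ⟨e', rfl⟩ := h3
      have hm : e * e' = -28 * (m₁ : ℤ) ^ 2 := mul_left_cancel₀ hl0 (by linear_combination h1)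
      have hns : ¬ IsSquare ((((84 * (m₁ : ℤ)) ^ 2 - 4 * (-28 * (m₁ : ℤ) ^ 2) : ℤ)) : ZMod l) := by
        rw [show ((84 * (m₁ : ℤ)) ^ 2 - 4 * (-28 * (m₁ : ℤ) ^ 2) : ℤ) = 7 * (32 * (m₁ : ℤ)) ^ 2 by ring]
        exact not_isSquare_mul_sq_zmod h32 (not_isSquare_seven_of_not_isSquare_neg_seven hl4 hl7)
      exact not_isSoluble_padic_of_prime_dvd_coeffs (p := l) (c := 84 * (m₁ : ℤ)) (by ring) rfl rfl
        hm hns (hpadic l)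
  have h14 : d ∣ 14 := by
    have h0 : d ∣ -28 * (m : ℤ) ^ 2 := ⟨d', hdd'⟩
    have h1 : d ∣ (14 * (m : ℤ)) ^ 2 := h0.trans ⟨-7, by ring⟩
    have h2 : d ∣ 14 * (m : ℤ) := (hsqf.dvd_pow_iff_dvd (by norm_num)).mp h1
    exact (isCoprime_of_forall_prime_not_dvd hld).dvd_of_dvd_mul_right h2
  have hle : d ≤ 14 := Int.le_of_dvd (by norm_num) h14
  have hge : -14 ≤ d := by
    have := Int.le_of_dvd (by norm_num) ((Int.neg_dvd).mpr h14)
    linarith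
  have hdisc7 : ∀ x y : ℤ, x * y = -28 * (m : ℤ) ^ 2 →
      (7 : ℤ) ∣ (84 * (m : ℤ)) ^ 2 - 4 * x * y ∧ ¬ (7 : ℤ) ^ 2 ∣ (84 * (m : ℤ)) ^ 2 - 4 * x * y := by
    intro x y hxy
    have e1 : (84 * (m : ℤ)) ^ 2 - 4 * x * y = 7168 * (m : ℤ) ^ 2 := by rw [mul_assoc, hxy]; ring
    rw [e1]
    exact ⟨⟨1024 * (m : ℤ) ^ 2, by ring⟩, not_sq_seven_dvd_of_not_dvd' hm7⟩
  have hnr1 := zmod_seven_nonresidues_neg_one_neg_sq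
  have hnr2 := zmod_seven_nonresidues_neg_two
  have hm1 : d ≠ -1 := by
    rintro rfl
    obtain ⟨hB1, hB2⟩ := hdisc7 (-1) d' hdd'.symm
    obtain ⟨-, r, hr⟩ := isSquare_zmod_of_isSoluble_padic (p := 7) (by norm_num) (by decide) hB1 hB2
      (hpadic 7)
    push_cast at hr
    exact hnr1.1 r hr.symm
  have hm2 : d ≠ -2 := by
    rintro rfl
    obtain ⟨hB1, hB2⟩ := hdisc7 (-2) d' hdd'.symm
    obtain ⟨-, r, hr⟩ := isSquare_zmod_of_isSoluble_padic (p := 7) (by norm_num) (by decide) hB1 hB2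
      (hpadic 7)
    push_cast at hr
    exact hnr2.1 r hr.symm
  have hnd7 : ∀ k : ℤ, ¬ (7 : ℤ) ∣ k → ¬ (7 : ℤ) ∣ k * (m : ℤ) ^ 2 := by
    intro k hk h
    have h7p : Prime (7 : ℤ) := Int.prime_iff_natAbs_prime.mpr (by norm_num)
    rcases h7p.dvd_or_dvd h with h5 | h5
    · exact hk h5
    · exact hm07 ((ZMod.intCast_zmod_eq_zero_iff_dvd _ 7).mpr (h7p.dvd_of_dvd_pow h5))
  have hp7 : d ≠ 7 := by
    rintro rfl
    have hd'1 : d' = -4 * (m : ℤ) ^ 2 := by linarith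
    subst hd'1
    have hsol := (isSoluble_map_twoIsogenyQuartic_comm (Int.castRingHom ℚ_[7]) (84 * (m : ℤ)) 7
      (-4 * (m : ℤ) ^ 2)).mp (hpadic 7)
    obtain ⟨hB1, hB2⟩ := hdisc7 (-4 * (m : ℤ) ^ 2) 7 (by ring)
    obtain ⟨-, r, hr⟩ := isSquare_zmod_of_isSoluble_padic (p := 7) (by norm_num) (hnd7 (-4) (by decide))
      hB1 hB2 hsol
    push_cast at hr
    exact hnr2.2.1 _ r (by exact_mod_cast hm07) hr.symm
  have hp14 : d ≠ 14 := by
    rintro rfl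
    have hd'1 : d' = -2 * (m : ℤ) ^ 2 := by linarith
    subst hd'1
    have hsol := (isSoluble_map_twoIsogenyQuartic_comm (Int.castRingHom ℚ_[7]) (84 * (m : ℤ)) 14
      (-2 * (m : ℤ) ^ 2)).mp (hpadic 7)
    obtain ⟨hB1, hB2⟩ := hdisc7 (-2 * (m : ℤ) ^ 2) 14 (by ring)
    obtain ⟨-, r, hr⟩ := isSquare_zmod_of_isSoluble_padic (p := 7) (by norm_num) (hnd7 (-2) (by decide))
      hB1 hB2 hsol
    push_cast at hr
    exact hnr2.2.2 _ r (by exact_mod_cast hm07) hr.symm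
  -- the prime `2`
  have h8cases := zmod_eight_of_mod_four_eq_one hm4
  have hp2 : d ≠ 2 := by
    rintro rfl
    have hd'1 : d' = -14 * (m : ℤ) ^ 2 := by linarith
    subst hd'1
    have hodd' : Odd (-7 * (m : ℤ) ^ 2) := (by decide : Odd (-7 : ℤ)).mul hmodd.pow
    have h8 : ((1 + 42 * (m : ℤ) + -7 * (m : ℤ) ^ 2 : ℤ) : ZMod 8) = 4 := by
      push_cast
      exact (zmod_eight_sums_inert (m : ZMod 8) h8cases).1
    exact not_isSoluble_two_of_even_coeffs (a := 84 * (m : ℤ)) (c := 42 * (m : ℤ)) (e := 1)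
      (e' := -7 * (m : ℤ) ^ 2) (by ring) (by ring) (by ring) odd_one hodd' h8 (hpadic 2)
  have hm14 : d ≠ -14 := by
    rintro rfl
    have hd'1 : d' = 2 * (m : ℤ) ^ 2 := by linarith
    subst hd'1
    have h8 : ((-7 + 42 * (m : ℤ) + (m : ℤ) ^ 2 : ℤ) : ZMod 8) = 4 := by
      push_cast
      exact (zmod_eight_sums_inert (m : ZMod 8) h8cases).2
    exact not_isSoluble_two_of_even_coeffs (a := 84 * (m : ℤ)) (c := 42 * (m : ℤ)) (e := -7)
      (e' := (m : ℤ) ^ 2) (by ring) (by ring) (by ring) (by decide) hmodd.pow h8 (hpadic 2)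
  obtain ⟨k, hk⟩ := h14
  interval_cases d <;> first | (exfalso; omega) | simp

end Summit.BirchSwinnertonDyer.BirchSwinnertonDyer.Theorems.GoldfeldGoodTwists

end
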